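import Literature.NumberTheory.Sieve.FouvryTenenbaumDivisorAPTuple
import Literature.NumberTheory.Sieve.DirichletTupleExpansion
import HarnessLib

/-!
# Drappeau's kernel `𝔲_R` against smooth variables, II: fine sub-boxes and the hyperbolic boundary

Topic `Literature/NumberTheory/Sieve`; theorems only (plus the bookkeeping definitions `subLo`, `subHi`),
everything PROVED (finite combinatorics and counting).  Second file of the treatment of the Type I sums of
S. Drappeau, PLMS 114 (2017) §6.2 (arXiv:1504.05549, p. 22): to feed smooth variables `m⃗ = (m_i)_{i<k}`, `n` in
dyadic boxes `(V_i, 2V_i]`, `(V_l, 2V_l]` and unit classes `mod L` (`FouvryTenenbaum2021.apBox`), cut by a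
hyperbola `ν (∏ mᵢ) n ≤ Y`, into Fouvry–Tenenbaum's Lemmas 4.12–4.13 (which take arbitrary SUB-INTERVALS of the
dyadic boxes but no hyperbolic window), one cuts every initial box into `H` sub-intervals
`(V(1 + τ/H), V(1 + (τ+1)/H)]` and, for each sub-box tuple, the last variable at the height
`min(2V_l, Y/(ν ∏ subHiᵢ))` below which the window holds automatically; the remaining boundary tuples are few:

* `subLo`, `subHi` and their elementary inequalities; `apBox_eq_biUnion`, `disjoint_apBox_sub` — the partition;
* `sum_window_decomp` — windowed sum = `H^k` window-free main sums + boundary sums;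
* `card_boundary_fibre_le`, `card_boundary_le` — the boundary holds `≤ k Y/(ν H) + ∏ (2Vᵢ)` tuples;
* `sum_apBox_inv_le_one`, `card_apBox_le` — `∑_{m ∈ (V,2V]} 1/m ≤ 1`, `#(V, 2V] ≤ 2V`.

## References

* S. Drappeau, Proc. London Math. Soc. (3) 114 (2017) 684–732, §6.2. [Drappeau2017]
* É. Fouvry, G. Tenenbaum, Trans. Amer. Math. Soc. 375 (2022), Lemmas 4.12–4.13 (`m ≃ M`: arbitrary
  sub-intervals of `]M, 2M]`). [FouvryTenenbaum2021]
-/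

open Finset Fintype Real
open scoped Classical

noncomputable section

namespace Literature.NumberTheory.Sieve

namespace DrappeauTypeI

open FouvryTenenbaum2021

/-! ### Fine sub-boxes of a dyadic range -/

/-- Lower end of the `τ`-th of `H` sub-intervals of `(V, 2V]`: `V (1 + τ/H)`. [folklore] -/
def subLo (V : ℝ) (H τ : ℕ) : ℝ := V * (1 + (τ : ℝ) / H)

/-- Upper end of the `τ`-th of `H` sub-intervals of `(V, 2V]`: `V (1 + (τ+1)/H)`. [folklore] -/
def subHi (V : ℝ) (H τ : ℕ) : ℝ := V * (1 + ((τ : ℝ) + 1) / H)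

/-- `subHi τ = subLo (τ + 1)`. [folklore] -/
theorem subHi_eq_subLo (V : ℝ) (H τ : ℕ) : subHi V H τ = subLo V H (τ + 1) := by
  simp [subHi, subLo]

/-- `subLo 0 = V`. [folklore] -/
theorem subLo_zero (V : ℝ) (H : ℕ) : subLo V H 0 = V := by simp [subLo]

/-- `subLo H = 2V` (`H ≥ 1`). [folklore] -/
theorem subLo_self (V : ℝ) {H : ℕ} (hH : 0 < H) : subLo V H H = 2 * V := by
  rw [subLo, div_self (by exact_mod_cast hH.ne')]; ring

/-- `V ≤ subLo τ`. [folklore] -/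
theorem le_subLo {V : ℝ} (hV : 0 ≤ V) (H τ : ℕ) : V ≤ subLo V H τ := by
  rw [subLo]
  have : 0 ≤ (τ : ℝ) / H := by positivity
  nlinarith

/-- `subLo` is monotone in `τ`. [folklore] -/
theorem subLo_mono {V : ℝ} (hV : 0 ≤ V) (H : ℕ) : Monotone (subLo V H) := by
  intro a b hab
  simp only [subLo]
  gcongr

/-- `subHi τ ≤ 2V` for `τ < H`. [folklore] -/
theorem subHi_le {V : ℝ} (hV : 0 ≤ V) {H τ : ℕ} (hτ : τ < H) : subHi V H τ ≤ 2 * V := by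
  have hH : 0 < H := by omega
  rw [subHi_eq_subLo, ← subLo_self V hH]
  exact subLo_mono hV H (by omega)

/-- `0 < subHi`, indeed `V < subHi` for `V > 0`. [folklore] -/
theorem subHi_pos {V : ℝ} (hV : 0 < V) (H τ : ℕ) : 0 < subHi V H τ := by
  rw [subHi]
  have : 0 ≤ ((τ : ℝ) + 1) / H := by positivity
  nlinarith

/-- `subLo τ / subHi τ ≥ 1 − 1/H` (`V > 0`, `H ≥ 1`). [folklore] -/
theorem one_sub_inv_le_subLo_div_subHi {V : ℝ} (hV : 0 < V) {H : ℕ} (hH : 0 < H) (τ : ℕ) :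
    1 - 1 / (H : ℝ) ≤ subLo V H τ / subHi V H τ := by
  have hH' : (0 : ℝ) < H := by exact_mod_cast hH
  have hhi := subHi_pos hV H τ
  rw [le_div_iff₀ hhi, subLo, subHi]
  have hτ : (0 : ℝ) ≤ τ := Nat.cast_nonneg τ
  field_simp
  nlinarith

/-- An interval with monotone breakpoints is the disjoint union of its pieces. [folklore] -/
theorem Ioc_eq_biUnion_of_monotone {b : ℕ → ℕ} (hb : Monotone b) (H : ℕ) :
    Ioc (b 0) (b H) = (Finset.range H).biUnion (fun τ => Ioc (b τ) (b (τ + 1))) := by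
  induction H with
  | zero => simp
  | succ H ih =>
    rw [Finset.range_add_one, Finset.biUnion_insert, ← ih, Finset.union_comm,
      Finset.Ioc_union_Ioc_eq_Ioc (hb (Nat.zero_le H)) (hb (Nat.le_succ H))]

/-- The pieces are pairwise disjoint. [folklore] -/
theorem disjoint_Ioc_of_monotone {b : ℕ → ℕ} (hb : Monotone b) {τ₁ τ₂ : ℕ} (h : τ₁ ≠ τ₂) :
    Disjoint (Ioc (b τ₁) (b (τ₁ + 1))) (Ioc (b τ₂) (b (τ₂ + 1))) := by
  wlog hlt : τ₁ < τ₂ generalizing τ₁ τ₂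
  · exact (this h.symm (lt_of_le_of_ne (not_lt.1 hlt) h.symm)).symm
  rw [Finset.disjoint_left]
  intro n h1 h2
  rw [Finset.mem_Ioc] at h1 h2
  have h3 : b (τ₁ + 1) ≤ b τ₂ := hb (by omega)
  omega

/-- **The `H` sub-boxes partition the box** `apBox V (2V) L t`, as a `biUnion` over `τ < H`. [folklore] -/
theorem apBox_eq_biUnion {V : ℝ} (hV : 0 ≤ V) {H : ℕ} (hH : 0 < H) (L : ℕ) (t : ℤ) :
    apBox V (2 * V) L t = (Finset.range H).biUnion (fun τ => apBox (subLo V H τ) (subHi V H τ) L t) := by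
  have hb : Monotone (fun τ => ⌊subLo V H τ⌋₊) := fun a b hab => Nat.floor_le_floor (subLo_mono hV H hab)
  unfold apBox
  rw [← Finset.filter_biUnion]
  congr 1
  have h := Ioc_eq_biUnion_of_monotone hb H
  simp only [subLo_zero, subLo_self V hH] at h
  rw [h]
  refine Finset.biUnion_congr rfl fun τ _ => ?_
  rw [subHi_eq_subLo]

/-- The sub-boxes are pairwise disjoint. [folklore] -/
theorem disjoint_apBox_sub {V : ℝ} (hV : 0 ≤ V) (H L : ℕ) (t : ℤ) {τ₁ τ₂ : ℕ} (h : τ₁ ≠ τ₂) :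
    Disjoint (apBox (subLo V H τ₁) (subHi V H τ₁) L t) (apBox (subLo V H τ₂) (subHi V H τ₂) L t) := by
  have hb : Monotone (fun τ => ⌊subLo V H τ⌋₊) := fun a b hab => Nat.floor_le_floor (subLo_mono hV H hab)
  unfold apBox
  rw [subHi_eq_subLo, subHi_eq_subLo]
  exact Finset.disjoint_filter_filter (disjoint_Ioc_of_monotone hb h)

/-! ### Cutting the last variable at the hyperbola -/

/-- **The window decomposition.**  Cut every initial box into its `H` sub-boxes; for a sub-box tuple `τ⃗` let
`cut τ⃗ ≤ 2Vl` be a height below which the window condition `W` holds automatically.  Then the windowed sum over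
the full boxes is the sum of the `H^k` "main" sums (last variable in `apBox Vl (cut τ⃗)`, no window) plus the
boundary sums (last variable above `⌊cut τ⃗⌋`, window kept). [folklore] -/
theorem sum_window_decomp {M : Type*} [AddCommMonoid M] {k : ℕ} {V : Fin k → ℝ} (hV : ∀ i, 0 ≤ V i)
    (Vl : ℝ) (L : ℕ) (t : Fin k → ℤ) (tl : ℤ) {H : ℕ} (hH : 0 < H)
    (cut : (Fin k → ℕ) → ℝ) (hcut : ∀ τ, cut τ ≤ 2 * Vl) (F : (Fin k → ℕ) → ℕ → M)
    (W : (Fin k → ℕ) → ℕ → Prop) [∀ m n, Decidable (W m n)]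
    (hW : ∀ τ ∈ piFinset (fun _ : Fin k => Finset.range H),
      ∀ m ∈ piFinset (fun i => apBox (subLo (V i) H (τ i)) (subHi (V i) H (τ i)) L (t i)),
      ∀ n ∈ apBox Vl (cut τ) L tl, W m n) :
    ∑ m ∈ piFinset (fun i => apBox (V i) (2 * V i) L (t i)), ∑ n ∈ apBox Vl (2 * Vl) L tl,
        (if W m n then F m n else 0) =
      ∑ τ ∈ piFinset (fun _ : Fin k => Finset.range H),
        ∑ m ∈ piFinset (fun i => apBox (subLo (V i) H (τ i)) (subHi (V i) H (τ i)) L (t i)),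
          ∑ n ∈ apBox Vl (cut τ) L tl, F m n +
      ∑ τ ∈ piFinset (fun _ : Fin k => Finset.range H),
        ∑ m ∈ piFinset (fun i => apBox (subLo (V i) H (τ i)) (subHi (V i) H (τ i)) L (t i)),
          ∑ n ∈ (apBox Vl (2 * Vl) L tl).filter (fun n => ⌊cut τ⌋₊ < n ∧ W m n), F m n := by
  -- partition the initial boxes
  have hpart : ∑ m ∈ piFinset (fun i => apBox (V i) (2 * V i) L (t i)), ∑ n ∈ apBox Vl (2 * Vl) L tl,
        (if W m n then F m n else 0) =
      ∑ τ ∈ piFinset (fun _ : Fin k => Finset.range H),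
        ∑ m ∈ piFinset (fun i => apBox (subLo (V i) H (τ i)) (subHi (V i) H (τ i)) L (t i)),
          ∑ n ∈ apBox Vl (2 * Vl) L tl, (if W m n then F m n else 0) := by
    rw [← TupleSums.sum_piFinset_biUnion (fun _ : Fin k => Finset.range H)
      (fun i τ => apBox (subLo (V i) H τ) (subHi (V i) H τ) L (t i))
      (fun i τ₁ _ τ₂ _ hne => disjoint_apBox_sub (hV i) H L (t i) hne)]
    have hfun : (fun i => apBox (V i) (2 * V i) L (t i)) =
        (fun i => (Finset.range H).biUnion fun τ => apBox (subLo (V i) H τ) (subHi (V i) H τ) L (t i)) :=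
      funext fun i => apBox_eq_biUnion (hV i) hH L (t i)
    rw [hfun]
  rw [hpart, ← Finset.sum_add_distrib]
  refine Finset.sum_congr rfl fun τ hτ => ?_
  rw [← Finset.sum_add_distrib]
  refine Finset.sum_congr rfl fun m hm => ?_
  -- split the last variable at `⌊cut τ⌋`
  rw [← Finset.sum_filter_add_sum_filter_not (apBox Vl (2 * Vl) L tl) (fun n => n ≤ ⌊cut τ⌋₊)]
  congr 1
  · -- the main part: `{n ∈ apBox Vl (2Vl) : n ≤ ⌊cut⌋} = apBox Vl cut`, and `W` holds there
    have hset : (apBox Vl (2 * Vl) L tl).filter (fun n => n ≤ ⌊cut τ⌋₊) = apBox Vl (cut τ) L tl := by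
      have hfl : ⌊cut τ⌋₊ ≤ ⌊2 * Vl⌋₊ := Nat.floor_le_floor (hcut τ)
      unfold apBox
      ext n
      simp only [Finset.mem_filter, Finset.mem_Ioc]
      constructor
      · rintro ⟨⟨⟨h1, _⟩, h3⟩, h4⟩; exact ⟨⟨h1, h4⟩, h3⟩
      · rintro ⟨⟨h1, h2⟩, h3⟩; exact ⟨⟨⟨h1, h2.trans hfl⟩, h3⟩, h2⟩
    rw [hset]
    exact Finset.sum_congr rfl fun n hn => if_pos (hW τ hτ m hm n hn)
  · rw [Finset.sum_filter, Finset.sum_filter]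
    refine Finset.sum_congr rfl fun n _ => ?_
    by_cases h1 : ⌊cut τ⌋₊ < n
    · by_cases h2 : W m n
      · rw [if_pos (not_le.2 h1), if_pos h2, if_pos ⟨h1, h2⟩]
      · rw [if_pos (not_le.2 h1), if_neg h2, if_neg (fun h => h2 h.2)]
    · rw [if_neg (fun h => h1 (not_le.1 h)), if_neg (fun h => h1 h.1)]

/-! ### The boundary count -/

/-- `⌊a⌋ − ⌊b⌋ ≤ a − b + 1` for `0 ≤ b ≤ a`, as a bound for `#(⌊b⌋, ⌊a⌋]`. [folklore] -/
theorem card_Ioc_floor_le {a b : ℝ} (hb : 0 ≤ b) (hab : b ≤ a) :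
    ((Ioc ⌊b⌋₊ ⌊a⌋₊).card : ℝ) ≤ a - b + 1 := by
  rw [Nat.card_Ioc]
  have h1 : (⌊a⌋₊ : ℝ) ≤ a := Nat.floor_le (hb.trans hab)
  have h2 : b < (⌊b⌋₊ : ℝ) + 1 := Nat.lt_floor_add_one b
  have h3 : ⌊b⌋₊ ≤ ⌊a⌋₊ := Nat.floor_le_floor hab
  push_cast [Nat.cast_sub h3]
  linarith

/-- **One boundary fibre.**  For `m⃗` in the sub-box `τ⃗` (so `subLo < mᵢ ≤ subHi`), `Y ≥ 0`, `ν ≥ 1`, and the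
cut `cut = min(2Vl, Y/(ν ∏ subHiᵢ))`: the last variables `n ≤ 2Vl` with `⌊cut⌋ < n` and `ν (∏mᵢ) n ≤ Y` number at
most `k Y/(ν H ∏ mᵢ) + 1`. [folklore] -/
theorem card_boundary_fibre_le {k : ℕ} {V : Fin k → ℝ} (hV : ∀ i, 0 < V i) {Vl Y : ℝ} (hY : 0 ≤ Y)
    {ν : ℕ} (hν : 0 < ν) {H : ℕ} (hH : 0 < H) (L : ℕ) (t : Fin k → ℤ) (tl : ℤ)
    {τ : Fin k → ℕ} {m : Fin k → ℕ}
    (hm : m ∈ piFinset (fun i => apBox (subLo (V i) H (τ i)) (subHi (V i) H (τ i)) L (t i))) :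
    ((((apBox Vl (2 * Vl) L tl).filter (fun n =>
        ⌊min (2 * Vl) (Y / (ν * ∏ i, subHi (V i) H (τ i)))⌋₊ < n ∧
          ((ν * ((∏ i, m i) * n) : ℕ) : ℝ) ≤ Y)).card : ℝ)) ≤
      (k : ℝ) * Y / (ν * H * ∏ i, (m i : ℝ)) + 1 := by
  set Q : ℝ := ∏ i, subHi (V i) H (τ i) with hQ
  set P : ℕ := ∏ i, m i with hP
  set cut : ℝ := min (2 * Vl) (Y / (ν * Q)) with hcutdef
  have hQpos : 0 < Q := Finset.prod_pos fun i _ => subHi_pos (hV i) H (τ i)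
  have hν' : (0 : ℝ) < ν := by exact_mod_cast hν
  have hH' : (0 : ℝ) < H := by exact_mod_cast hH
  -- coordinates of `m`
  have hmi : ∀ i, subLo (V i) H (τ i) < m i ∧ (m i : ℝ) ≤ subHi (V i) H (τ i) := by
    intro i
    have h := Fintype.mem_piFinset.1 hm i
    unfold apBox at h
    rw [Finset.mem_filter, Finset.mem_Ioc] at h
    constructor
    · exact lt_of_lt_of_le (Nat.lt_floor_add_one _) (by exact_mod_cast h.1.1)
    · have h2 := h.1.2
      have hpos : 0 ≤ subHi (V i) H (τ i) := (subHi_pos (hV i) H (τ i)).le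
      exact le_trans (by exact_mod_cast h2) (Nat.floor_le hpos)
  have hPpos : (0 : ℝ) < P := by
    rw [hP]; push_cast
    exact Finset.prod_pos fun i _ => lt_of_le_of_lt (le_trans (hV i).le (le_subLo (hV i).le H (τ i))) (hmi i).1
  have hPQ : (P : ℝ) ≤ Q := by
    rw [hP, hQ]; push_cast
    exact Finset.prod_le_prod (fun i _ => (Nat.cast_nonneg _)) fun i _ => (hmi i).2
  -- `P/Q ≥ (1 - 1/H)^k ≥ 1 - k/H`
  have hratio : 1 - (k : ℝ) / H ≤ (P : ℝ) / Q := by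
    have h1 : (1 - 1 / (H : ℝ)) ^ k ≤ (P : ℝ) / Q := by
      have hconst : (1 - 1 / (H : ℝ)) ^ k = ∏ _i : Fin k, (1 - 1 / (H : ℝ)) := by
        rw [Finset.prod_const, Finset.card_univ, Fintype.card_fin]
      rw [hP, hQ, Nat.cast_prod, ← Finset.prod_div_distrib, hconst]
      refine Finset.prod_le_prod (fun i _ => ?_) fun i _ => ?_
      · rw [sub_nonneg, div_le_one hH']; exact_mod_cast hH
      · exact (one_sub_inv_le_subLo_div_subHi (hV i) hH (τ i)).trans
          (div_le_div_of_nonneg_right (hmi i).1.le (subHi_pos (hV i) H (τ i)).le)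
    have h2 : 1 - (k : ℝ) / H ≤ (1 - 1 / (H : ℝ)) ^ k := by
      have := one_add_mul_le_pow (a := -(1 / (H : ℝ))) (by
        have : 1 / (H : ℝ) ≤ 1 := by rw [div_le_one hH']; exact_mod_cast hH
        linarith) k
      calc 1 - (k : ℝ) / H = 1 + k * (-(1 / (H : ℝ))) := by ring
        _ ≤ (1 + -(1 / (H : ℝ))) ^ k := this
        _ = (1 - 1 / (H : ℝ)) ^ k := by ring
    exact h2.trans h1
  set S := (apBox Vl (2 * Vl) L tl).filter (fun n => ⌊cut⌋₊ < n ∧ ((ν * (P * n) : ℕ) : ℝ) ≤ Y) with hS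
  rcases S.eq_empty_or_nonempty with hempty | ⟨n₀, hn₀⟩
  · rw [hempty, Finset.card_empty, Nat.cast_zero]
    positivity
  · -- the cut is the hyperbola, not `2Vl`
    have hn₀' := hn₀
    rw [hS, Finset.mem_filter] at hn₀'
    obtain ⟨hn₀box, hn₀cut, hn₀W⟩ := hn₀'
    unfold apBox at hn₀box
    rw [Finset.mem_filter, Finset.mem_Ioc] at hn₀box
    have hcutlt : cut < n₀ := lt_of_lt_of_le (Nat.lt_floor_add_one cut) (by exact_mod_cast hn₀cut)
    have hn₀le : (n₀ : ℝ) ≤ 2 * Vl := by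
      have := hn₀box.1.2
      rcases le_or_gt 0 (2 * Vl) with h | h
      · exact le_trans (by exact_mod_cast this) (Nat.floor_le h)
      · exfalso
        rw [Nat.floor_of_nonpos h.le] at this
        omega
    have hcut_eq : cut = Y / (ν * Q) := by
      rw [hcutdef]
      refine min_eq_right ?_
      by_contra hcon
      push Not at hcon
      have : cut = 2 * Vl := by rw [hcutdef]; exact min_eq_left hcon.le
      linarith
    -- `S ⊆ (⌊Y/(νQ)⌋, ⌊Y/(νP)⌋]`
    have hsub : S ⊆ Ioc ⌊Y / (ν * Q)⌋₊ ⌊Y / (ν * P)⌋₊ := by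
      intro n hn
      rw [hS, Finset.mem_filter] at hn
      obtain ⟨-, hncut, hnW⟩ := hn
      rw [Finset.mem_Ioc]
      refine ⟨by rwa [hcut_eq] at hncut, Nat.le_floor ?_⟩
      rw [le_div_iff₀ (mul_pos hν' hPpos)]
      push_cast at hnW
      nlinarith
    have hb0 : 0 ≤ Y / (ν * Q) := by positivity
    have hab : Y / (ν * Q) ≤ Y / (ν * P) := by
      apply div_le_div_of_nonneg_left hY (mul_pos hν' hPpos)
      exact mul_le_mul_of_nonneg_left hPQ hν'.le
    calc (S.card : ℝ) ≤ ((Ioc ⌊Y / (ν * Q)⌋₊ ⌊Y / (ν * P)⌋₊).card : ℝ) := by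
          exact_mod_cast Finset.card_le_card hsub
      _ ≤ Y / (ν * P) - Y / (ν * Q) + 1 := card_Ioc_floor_le hb0 hab
      _ = Y / (ν * P) * (1 - P / Q) + 1 := by field_simp
      _ ≤ Y / (ν * P) * ((k : ℝ) / H) + 1 := by
          gcongr
          linarith
      _ = (k : ℝ) * Y / (ν * H * ∏ i, (m i : ℝ)) + 1 := by
          rw [hP, Nat.cast_prod]
          field_simp

/-- `∑_{m ∈ apBox V (2V)} 1/m ≤ 1` (at most `⌊V⌋ + 1` terms, each `≤ 1/(⌊V⌋+1)`). [folklore] -/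
theorem sum_apBox_inv_le_one (V : ℝ) (L : ℕ) (t : ℤ) : ∑ m ∈ apBox V (2 * V) L t, (1 : ℝ) / m ≤ 1 := by
  unfold apBox
  calc ∑ m ∈ (Ioc ⌊V⌋₊ ⌊2 * V⌋₊).filter (fun m : ℕ => (m : ZMod L) = (t : ZMod L)), (1 : ℝ) / m
      ≤ ∑ m ∈ Ioc ⌊V⌋₊ ⌊2 * V⌋₊, (1 : ℝ) / m :=
        Finset.sum_le_sum_of_subset_of_nonneg (Finset.filter_subset _ _) fun _ _ _ => by positivity
    _ ≤ ∑ _m ∈ Ioc ⌊V⌋₊ ⌊2 * V⌋₊, (1 : ℝ) / (⌊V⌋₊ + 1) := by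
        refine Finset.sum_le_sum fun m hm => ?_
        rw [Finset.mem_Ioc] at hm
        apply div_le_div_of_nonneg_left zero_le_one (by positivity)
        exact_mod_cast hm.1
    _ = ((⌊2 * V⌋₊ - ⌊V⌋₊ : ℕ) : ℝ) * (1 / (⌊V⌋₊ + 1)) := by rw [Finset.sum_const, Nat.card_Ioc, nsmul_eq_mul]
    _ ≤ ((⌊V⌋₊ + 1 : ℕ) : ℝ) * (1 / (⌊V⌋₊ + 1)) := by
        gcongr
        -- `⌊2V⌋ ≤ 2⌊V⌋ + 1`
        rcases le_or_gt 0 V with hV | hV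
        · have h1 : (⌊2 * V⌋₊ : ℝ) ≤ 2 * V := Nat.floor_le (by linarith)
          have h2 : V < (⌊V⌋₊ : ℝ) + 1 := Nat.lt_floor_add_one V
          have h3 : (⌊2 * V⌋₊ : ℝ) < 2 * ⌊V⌋₊ + 2 := by linarith
          have h4 : ⌊2 * V⌋₊ < 2 * ⌊V⌋₊ + 2 := by exact_mod_cast h3
          omega
        · rw [Nat.floor_of_nonpos (by linarith : 2 * V ≤ 0)]
          omega
    _ = 1 := by
        have : (0 : ℝ) < (⌊V⌋₊ : ℝ) + 1 := by positivity
        push_cast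
        field_simp

/-- `#apBox V (2V) ≤ ⌊V⌋ + 1 ≤ 2V` for `V ≥ 1`. [folklore] -/
theorem card_apBox_le {V : ℝ} (hV : 1 ≤ V) (L : ℕ) (t : ℤ) : ((apBox V (2 * V) L t).card : ℝ) ≤ 2 * V := by
  unfold apBox
  have h1 : ((Ioc ⌊V⌋₊ ⌊2 * V⌋₊).card : ℝ) ≤ 2 * V := by
    rw [Nat.card_Ioc]
    have h1 : (⌊2 * V⌋₊ : ℝ) ≤ 2 * V := Nat.floor_le (by linarith)
    have h3 : ⌊V⌋₊ ≤ ⌊2 * V⌋₊ := Nat.floor_le_floor (by linarith)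
    push_cast [Nat.cast_sub h3]
    have : (0 : ℝ) ≤ ⌊V⌋₊ := Nat.cast_nonneg _
    linarith
  exact le_trans (by exact_mod_cast Finset.card_le_card (Finset.filter_subset _ _)) h1

/-- **The total boundary count**: summed over all sub-box tuples and all initial tuples in them, the boundary
fibres hold at most `k 2^k Y/(ν H) + 2^k ∏ Vᵢ`... precisely `k Y/(ν H) + ∏ (2 Vᵢ)` tuples. [folklore] -/
theorem card_boundary_le {k : ℕ} {V : Fin k → ℝ} (hV : ∀ i, 1 ≤ V i) {Vl Y : ℝ} (hY : 0 ≤ Y)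
    {ν : ℕ} (hν : 0 < ν) {H : ℕ} (hH : 0 < H) (L : ℕ) (t : Fin k → ℤ) (tl : ℤ) :
    ∑ τ ∈ piFinset (fun _ : Fin k => Finset.range H),
      ∑ m ∈ piFinset (fun i => apBox (subLo (V i) H (τ i)) (subHi (V i) H (τ i)) L (t i)),
        ((((apBox Vl (2 * Vl) L tl).filter (fun n =>
            ⌊min (2 * Vl) (Y / (ν * ∏ i, subHi (V i) H (τ i)))⌋₊ < n ∧
              ((ν * ((∏ i, m i) * n) : ℕ) : ℝ) ≤ Y)).card : ℝ)) ≤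
      (k : ℝ) * Y / (ν * H) + ∏ i, (2 * V i) := by
  have hV0 : ∀ i, 0 < V i := fun i => lt_of_lt_of_le one_pos (hV i)
  calc _ ≤ ∑ τ ∈ piFinset (fun _ : Fin k => Finset.range H),
        ∑ m ∈ piFinset (fun i => apBox (subLo (V i) H (τ i)) (subHi (V i) H (τ i)) L (t i)),
          ((k : ℝ) * Y / (ν * H * ∏ i, (m i : ℝ)) + 1) :=
        Finset.sum_le_sum fun τ _ => Finset.sum_le_sum fun m hm => card_boundary_fibre_le hV0 hY hν hH L t tl hm
    _ = ∑ m ∈ piFinset (fun i => apBox (V i) (2 * V i) L (t i)),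
          ((k : ℝ) * Y / (ν * H * ∏ i, (m i : ℝ)) + 1) := by
        rw [← TupleSums.sum_piFinset_biUnion (fun _ : Fin k => Finset.range H)
          (fun i τ => apBox (subLo (V i) H τ) (subHi (V i) H τ) L (t i))
          (fun i τ₁ _ τ₂ _ hne => disjoint_apBox_sub (hV0 i).le H L (t i) hne)]
        have hfun : (fun i => apBox (V i) (2 * V i) L (t i)) =
            (fun i => (Finset.range H).biUnion fun τ => apBox (subLo (V i) H τ) (subHi (V i) H τ) L (t i)) :=
          funext fun i => apBox_eq_biUnion (hV0 i).le hH L (t i)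
        rw [hfun]
    _ = (k : ℝ) * Y / (ν * H) * ∑ m ∈ piFinset (fun i => apBox (V i) (2 * V i) L (t i)),
          ∏ i, (1 : ℝ) / (m i) + ((piFinset (fun i => apBox (V i) (2 * V i) L (t i))).card : ℝ) := by
        rw [Finset.sum_add_distrib, Finset.sum_const, nsmul_eq_mul, mul_one, Finset.mul_sum]
        congr 1
        refine Finset.sum_congr rfl fun m _ => ?_
        rw [Finset.prod_div_distrib, Finset.prod_const_one]
        ring
    _ ≤ (k : ℝ) * Y / (ν * H) * 1 + ∏ i, (2 * V i) := by
        gcongr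
        · rw [← Finset.prod_univ_sum (fun i => apBox (V i) (2 * V i) L (t i)) (fun i m => (1 : ℝ) / m)]
          calc ∏ i, ∑ m ∈ apBox (V i) (2 * V i) L (t i), (1 : ℝ) / m ≤ ∏ _i : Fin k, (1 : ℝ) :=
                Finset.prod_le_prod (fun i _ => Finset.sum_nonneg fun _ _ => by positivity)
                  fun i _ => sum_apBox_inv_le_one (V i) L (t i)
            _ = 1 := Finset.prod_const_one
        · rw [Fintype.card_piFinset, Nat.cast_prod]
          exact Finset.prod_le_prod (fun i _ => Nat.cast_nonneg _) fun i _ => card_apBox_le (hV i) L (t i)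
    _ = _ := by rw [mul_one]

end DrappeauTypeI

end Literature.NumberTheory.Sieve

end
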